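import Literature.MathematicalPhysics.QuantumFieldTheory.Balaban1983to89.B9IndexBondAtLevel

/-!
# `Balaban1983to89.B9IndexBondFaithful` — a block map `fine bonds → index bonds` that is LEVEL-FAITHFUL, CARRIER-FAITHFUL and
# 1-FAITHFUL exists at every k-level V1 member (the three geometric binders `hlev`, `hβI`, `hβ1` of the N06 knit's coordinate pins)

T. Bałaban, *Propagators and renormalization transformations for lattice gauge theories. II*, Commun. Math. Phys. **96** (1984) 223–250
[`Balaban1984PropagatorsII`, "[4]"], (2.1)–(2.4) p. 224 (blocks of side L; *"Λ_j also denotes the set of bonds with at least one end-point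
in Λ_j"*), (2.45)–(2.46) p. 231 (𝔅 = ⋃_j Λ_j, the admissible bonds, the distance d(y, y′)); T. Bałaban, *Propagators for lattice gauge
theories in a background field*, Commun. Math. Phys. **99** (1985) 389–434 [`Balaban1985BackgroundPropagators`, "B9"], (3.41) p. 397,
(3.46)–(3.47) p. 398 (*"supp h ⊂ Δ(y), y ∈ Λ_j, supp λ ⊂ Δ(y′)"*).

statement-level skeleton of published theorems with citation tags; proofs where landed; nothing here is a claim about the
Yang–Mills mass gap

THE POINT.  The N06 knit reads def-Y's bond-sector kernels through a block map `bI : fine bonds → index bonds` (n06-d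
`B9CoReadingCoords.blkBK bI`).  Three geometric properties of `bI` are displayed as binders of the knit's certificate:
* `hlev` (LEVEL-FAITHFUL): `lvl (bI x) = level of the block of x` — n06-l `B9IndexBondAtLevel.exists_levelFaithful` proves one exists;
* `hβI` (CARRIER-FAITHFUL): whenever the block of `x` IS the carrier block `β c` of some index bond, `β (bI x)` is the block of `x`
  (n06-d `B9CoReadingCoords.off_bound_evBK`, `B9CoReadingCoordsGlob`);
* `hβ1` (1-FAITHFUL): `d_T(β (bI x), block of x) ≤ 1` always (n06-k `B9CoReadingCoordsL2.l2ReadsNbr_kernelFamilyB_coords_*`, the (3.46)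
  co-readings at observation radius 2 — at members with ORPHAN blocks the block of `x` carries no index bond and `bI x` can only sit
  one block away).
THIS FILE proves that ONE map with ALL THREE properties exists at every member (★ `exists_faithful`, `exists_faithful_kIdx`), so the
instance seat may take `bI := (exists_faithful_kIdx i).choose` and discharge the three binders at once.  Construction: if the block of
`x` is a carrier block `β c`, take such a `c` (distance 0; level by `beta_level`).  Otherwise re-run [4] (2.3) as in n06-l's
`exists_bondIdx_lvl_eq` but KEEP THE LOCATION: with j the level and y₀ the j-block of x₋, the index bond is ⟨y₀, y₀ + e₀⟩ (top level)
or the sibling bond of y₀ inside its parent block (`B9IndexBondAtLevel.exists_sibling_bond`); its base end-point is y₀ or a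
neighbour y₀ ± e_μ of y₀ ON THE LEVEL-j LATTICE, and two j-blocks that are lattice neighbours TOUCH on the torus (2.46): the last fine
site of the one and the first fine site of the other along μ are at torus sup-distance 1 (`torusSupNorm_sibling_le_one`, wrap-around
included since L^j·(2L^{m+K−j}) is the period), so their graph distance in `geomT` is ≤ 1.
* §1 fine sites over a j-block with prescribed offsets (`exists_fine_over`), the period identity, the torus adjacency of siblings;
* §2 ★ `exists_bondIdx_near` (an index bond of the right level at block-distance ≤ 1, equal to the carrier when possible),
  ★ `exists_faithful`; §3 `exists_faithful_kIdx` at a census index.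

HONEST SCOPE.  Lattice combinatorics of the tree's own domain datum; nothing of [4] or [B9] asserted; count-neutral; N06 NOT discharged;
nothing continuum, nothing about the mass gap.  Cell `pub-ymgap` (HUMAN RULING D-0062), Track A node N06 [B9], seat `pub-ymgap-dag-n06-k` (g8), 2026-08-27.
-/

namespace Literature.MathematicalPhysics.QuantumFieldTheory.Balaban1983to89.B9IndexBondFaithful

open LatticeFieldCalculus
open B4Reflection242 (boxDom mem_boxDom blk)
open B4TorusKernel.MultiPeriod (circAbs circAbs_nonneg circAbs_le_abs circAbs_add_mul torusSupNorm)
open B5Eq118OneStroke (iterBlockOf iterBlockOf_zero iterBlockOf_succ val_iterBlockOf)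
open B6MultiLevelBoxOperator (N0 bigSide Domains)
open B6MultiLevelTorusOperator (TDomains)
open B6Geom246MultiLevelBox (bset blkOf blkOf_val)
open B6Geom246MultiLevelTorus (TouchT bondT bondT_adj touchT_symm geomT realizesT)
open B6Geometry (dist_self_of_realizes)
open B6GlobalChartV1 (PV toBox toBox_apply domT blkV1 iterBlockOf_mem_domT_iff)
open B6ScalarChartV1 (blkOf_toBox_eq_iff)
open B6SectAOperatorsV1 (BondIdx)
open B6Ineq2142KLevelV1 (lvl base β beta_level blkOf_eq_beta base_mem not_deep_base one_le_lvl lvl_le)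
open B6KLevelCensusIndexV1 (KIdx)
open B9IndexBondAtLevel (exists_sibling_bond)

variable {d ℓ : ℕ} {m K : ℕ} {hd : 1 ≤ d + 1} {hL : Odd (ℓ + 1) ∧ 1 < ℓ + 1}

/-! ## §1 Fine sites over a `j`-block; the torus adjacency of sibling blocks -/

section Fine

variable {Mh k R : ℕ} {P' : Fin (d + 1) → ℕ}
variable (hN : ∀ μ, N0 ℓ Mh k P' μ = (PV d ℓ m K hd hL).sitesPerDir 0)

/-- no wrap-around: `(a + 1).val = a.val + 1` below the period. [folklore] -/
private theorem val_add_one {n : ℕ} (a : ZMod n) (h : a.val + 1 < n) : (a + 1).val = a.val + 1 := by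
  haveI : Fact (1 < n) := ⟨by omega⟩
  rw [ZMod.val_add_of_lt (by rwa [ZMod.val_one]), ZMod.val_one]

/-- wrap-around: the successor of the last label is `0`. [folklore] -/
private theorem add_one_eq_zero {n : ℕ} [NeZero n] (a : ZMod n) (h : a.val + 1 = n) : a + 1 = 0 := by
  have h1 : (((a.val + 1 : ℕ)) : ZMod n) = 0 := by rw [h, ZMod.natCast_self]
  rwa [Nat.cast_add, Nat.cast_one, ZMod.natCast_zmod_val] at h1

/-- **THE PERIOD IDENTITY** `(2L^{m+K−j})·L^j = 2L^{m+K}`: `L^j` fine steps per `j`-block label, over the whole period. [cite: Balaban1984PropagatorsI, (1.6) p.18, bookkeeping] -/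
theorem sitesPerDir_mul_pow {j : ℕ} (hj : j ≤ m + K) :
    (PV d ℓ m K hd hL).sitesPerDir j * (ℓ + 1) ^ j = (PV d ℓ m K hd hL).sitesPerDir 0 := by
  show 2 * (ℓ + 1) ^ (m + K - j) * (ℓ + 1) ^ j = 2 * (ℓ + 1) ^ (m + K - 0)
  rw [Nat.sub_zero, mul_assoc, ← pow_add, Nat.sub_add_cancel hj]

/-- **FINE SITES OVER A `j`-BLOCK WITH PRESCRIBED OFFSETS**: for offsets `off μ < L^j` the fine site of labels `(y μ)·L^j + off μ` lies in
`B^j(y)` ((1.6): `B^j(y)` is the cube of side `L^j` over `y`). [cite: Balaban1984PropagatorsI, (1.6) p.18, (1.18) p.20] -/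
theorem exists_fine_over {j : ℕ} (hj : j ≤ m + K) (y : Site (PV d ℓ m K hd hL) j) (off : Fin (d + 1) → ℕ)
    (hoff : ∀ μ, off μ < (ℓ + 1) ^ j) :
    ∃ w : Site (PV d ℓ m K hd hL) 0, iterBlockOf j w = y ∧ ∀ μ, (w μ).val = (y μ).val * (ℓ + 1) ^ j + off μ := by
  have hlt : ∀ μ, (y μ).val * (ℓ + 1) ^ j + off μ < (PV d ℓ m K hd hL).sitesPerDir 0 := by
    intro μ
    have hy : (y μ).val + 1 ≤ (PV d ℓ m K hd hL).sitesPerDir j := ZMod.val_lt (y μ)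
    have hoffμ := hoff μ
    calc (y μ).val * (ℓ + 1) ^ j + off μ < (y μ).val * (ℓ + 1) ^ j + (ℓ + 1) ^ j := by omega
      _ = ((y μ).val + 1) * (ℓ + 1) ^ j := by ring
      _ ≤ (PV d ℓ m K hd hL).sitesPerDir j * (ℓ + 1) ^ j := Nat.mul_le_mul_right _ hy
      _ = (PV d ℓ m K hd hL).sitesPerDir 0 := sitesPerDir_mul_pow hj
  have hval : ∀ μ, ((((y μ).val * (ℓ + 1) ^ j + off μ : ℕ)) : ZMod ((PV d ℓ m K hd hL).sitesPerDir 0)).val =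
      (y μ).val * (ℓ + 1) ^ j + off μ := fun μ => by rw [ZMod.val_natCast, Nat.mod_eq_of_lt (hlt μ)]
  refine ⟨fun μ => ((((y μ).val * (ℓ + 1) ^ j + off μ : ℕ)) : ZMod ((PV d ℓ m K hd hL).sitesPerDir 0)), ?_, hval⟩
  funext μ
  apply ZMod.val_injective
  have h := val_iterBlockOf (P := PV d ℓ m K hd hL) j hj
    (fun μ => ((((y μ).val * (ℓ + 1) ^ j + off μ : ℕ)) : ZMod ((PV d ℓ m K hd hL).sitesPerDir 0))) μ
  rw [h, hval μ]
  show ((y μ).val * (ℓ + 1) ^ j + off μ) / (ℓ + 1) ^ j = (y μ).val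
  have hLj : 0 < (ℓ + 1) ^ j := pow_pos (Nat.succ_pos ℓ) j
  rw [mul_comm, Nat.mul_add_div hLj, Nat.div_eq_of_lt (hoff μ), add_zero]

/-- `(x + e_μ)_μ = x_μ + 1`. [folklore] -/
private theorem shift_apply_self {P : Params} {j : ℕ} (x : Site P j) (μ : Fin P.d) : (x.shift μ) μ = x μ + 1 := by
  simp [Site.shift]

/-- `(x + e_μ)_ν = x_ν` for `ν ≠ μ`. [folklore] -/
private theorem shift_apply_ne {P : Params} {j : ℕ} (x : Site P j) {μ ν : Fin P.d} (h : ν ≠ μ) : (x.shift μ) ν = x ν := by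
  simp [Site.shift, Function.update_of_ne h]

include hN in
/-- **LATTICE-NEIGHBOUR `j`-BLOCKS TOUCH ON THE TORUS**: the last fine site of `B^j(y)` along `μ₀` and the first fine site of `B^j(y + e_{μ₀})`
are at torus sup-distance `≤ 1` — wrap-around included, the period being `L^j·(2L^{m+K−j})`. [cite: Balaban1984PropagatorsII, (2.46) p.231 («admissible bonds»), (2.1) p.224] -/
theorem torusSupNorm_sibling_le_one {j : ℕ} (hj : j ≤ m + K) (y : Site (PV d ℓ m K hd hL) j) (μ₀ : Fin (d + 1))
    {w₀ w₁ : Site (PV d ℓ m K hd hL) 0}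
    (hw₀ : ∀ μ, (w₀ μ).val = (y μ).val * (ℓ + 1) ^ j + (if μ = μ₀ then (ℓ + 1) ^ j - 1 else 0))
    (hw₁ : ∀ μ, (w₁ μ).val = ((y.shift μ₀) μ).val * (ℓ + 1) ^ j + 0) :
    torusSupNorm (N0 ℓ Mh k P') ((toBox hN w₁ : Fin (d + 1) → ℤ) - (toBox hN w₀ : Fin (d + 1) → ℤ)) ≤ 1 := by
  have hN1 : ∀ μ, 1 ≤ N0 ℓ Mh k P' μ := fun μ => by
    rw [hN μ]; exact Nat.one_le_iff_ne_zero.2 (Params.sitesPerDir_ne_zero _ _)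
  have hL1 : 1 ≤ (ℓ + 1) ^ j := Nat.one_le_pow _ _ (Nat.succ_pos ℓ)
  unfold torusSupNorm
  refine Finset.sup'_le _ _ fun μ _ => ?_
  have hcoord : ((toBox hN w₁ : Fin (d + 1) → ℤ) - (toBox hN w₀ : Fin (d + 1) → ℤ)) μ = ((w₁ μ).val : ℤ) - ((w₀ μ).val : ℤ) := by
    rw [Pi.sub_apply, toBox_apply, toBox_apply]
  rw [hcoord, hw₀ μ, hw₁ μ]
  by_cases hμ : μ = μ₀
  · subst hμ
    rw [if_pos rfl, shift_apply_self]
    by_cases hwrap : (y μ).val + 1 < (PV d ℓ m K hd hL).sitesPerDir j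
    · rw [val_add_one (y μ) hwrap]
      have h1 : ((((y μ).val + 1) * (ℓ + 1) ^ j + 0 : ℕ) : ℤ) - (((y μ).val * (ℓ + 1) ^ j + ((ℓ + 1) ^ j - 1) : ℕ) : ℤ) = 1 := by
        push_cast [Nat.cast_sub hL1]; ring
      rw [h1]
      exact_mod_cast (circAbs_le_abs (hN1 μ) 1).trans (by norm_num)
    · have heq : (y μ).val + 1 = (PV d ℓ m K hd hL).sitesPerDir j := le_antisymm (ZMod.val_lt _) (not_lt.1 hwrap)
      rw [add_one_eq_zero (y μ) heq, ZMod.val_zero]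
      have hS : (PV d ℓ m K hd hL).sitesPerDir 0 = ((y μ).val + 1) * (ℓ + 1) ^ j := by
        rw [heq]; exact (sitesPerDir_mul_pow hj).symm
      have hper : (((PV d ℓ m K hd hL).sitesPerDir 0 : ℕ) : ℤ) = (((y μ).val * (ℓ + 1) ^ j + ((ℓ + 1) ^ j - 1) : ℕ) : ℤ) + 1 := by
        rw [hS]; push_cast [Nat.cast_sub hL1]; ring
      have h1 : (((0 : ℕ) * (ℓ + 1) ^ j + 0 : ℕ) : ℤ) - (((y μ).val * (ℓ + 1) ^ j + ((ℓ + 1) ^ j - 1) : ℕ) : ℤ) =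
          1 + ((N0 ℓ Mh k P' μ : ℕ) : ℤ) * (-1) := by
        rw [hN μ, hper]; push_cast; ring
      rw [h1, circAbs_add_mul]
      exact_mod_cast (circAbs_le_abs (hN1 μ) 1).trans (by norm_num)
  · rw [if_neg hμ, shift_apply_ne y hμ, sub_self]
    exact_mod_cast (circAbs_le_abs (hN1 μ) 0).trans (by norm_num)

end Fine

/-! ## §2 An index bond of the right level at block-distance `≤ 1`, equal to the carrier when there is one; the faithful map -/

section IndexBonds

variable {Mh k R : ℕ} {P' : Fin (d + 1) → ℕ}
variable (hN : ∀ μ, N0 ℓ Mh k P' μ = (PV d ℓ m K hd hL).sitesPerDir 0) (D : TDomains d ℓ Mh k P' R) (hk : k ≤ m + K)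

/-- graph distance `≤ 1` in `geomT` from «equal or touching». [cite: Balaban1984PropagatorsII, (2.46) p.231] -/
theorem distT_le_one_of_touch {s t : ↥(bset D.toDomains)} (h : s = t ∨ TouchT D s t) : (geomT D).dist s t ≤ 1 := by
  show (((bondT D).dist s t : ℕ) : ℝ) ≤ 1
  rcases h with h | h
  · subst h; rw [SimpleGraph.dist_self, Nat.cast_zero]; exact zero_le_one
  · by_cases hst : s = t
    · subst hst; rw [SimpleGraph.dist_self, Nat.cast_zero]; exact zero_le_one
    · rw [SimpleGraph.dist_eq_one_iff_adj.2 (bondT_adj.2 ⟨hst, h⟩), Nat.cast_one]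

/-- **TWO LATTICE-NEIGHBOUR `j`-BLOCKS OF `𝔅` ARE AT DISTANCE `≤ 1`**: if the blocks `s`, `t ∈ 𝔅` contain the fine sites over `y` and over
`y + e_{μ₀}` respectively (at a level `j` where both are `j`-blocks of `𝔅`), then `d_T(s, t) ≤ 1` and `d_T(t, s) ≤ 1`.
[cite: Balaban1984PropagatorsII, (2.46) p.231, (2.1) p.224] -/
theorem distT_le_one_of_sibling {j : ℕ} (hj : j ≤ m + K) (y : Site (PV d ℓ m K hd hL) j) (μ₀ : Fin (d + 1))
    {s t : ↥(bset D.toDomains)}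
    (hs : ∀ w : Site (PV d ℓ m K hd hL) 0, iterBlockOf j w = y → blkOf D.toDomains (toBox hN w) = s)
    (ht : ∀ w : Site (PV d ℓ m K hd hL) 0, iterBlockOf j w = y.shift μ₀ → blkOf D.toDomains (toBox hN w) = t) :
    (geomT D).dist s t ≤ 1 ∧ (geomT D).dist t s ≤ 1 := by
  have hL1 : 1 ≤ (ℓ + 1) ^ j := Nat.one_le_pow _ _ (Nat.succ_pos ℓ)
  obtain ⟨w₀, hw₀y, hw₀⟩ := exists_fine_over (hd := hd) (hL := hL) hj y
    (fun μ => if μ = μ₀ then (ℓ + 1) ^ j - 1 else 0) (fun μ => by split_ifs <;> omega)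
  obtain ⟨w₁, hw₁y, hw₁⟩ := exists_fine_over (hd := hd) (hL := hL) hj (y.shift μ₀) (fun _ => 0) (fun _ => by omega)
  have htouch : TouchT D t s :=
    ⟨toBox hN w₁, toBox hN w₀, ht w₁ hw₁y, hs w₀ hw₀y, torusSupNorm_sibling_le_one hN hj y μ₀ hw₀ hw₁⟩
  exact ⟨distT_le_one_of_touch D (Or.inr (touchT_symm htouch)), distT_le_one_of_touch D (Or.inr htouch)⟩

/-- ★ **AN INDEX BOND OF THE RIGHT LEVEL WITHIN BLOCK-DISTANCE 1, EQUAL TO THE CARRIER WHEN THERE IS ONE**: for every fine bond `x` there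
is an index bond `c` with `lvl c = level of the block of x`, `d_T(β c, block of x) ≤ 1`, and `β c = block of x` as soon as the block of
`x` is the carrier block of ANY index bond.  [4] (2.3) read on the tree's `domT`: the carrier case is immediate; otherwise the bond
⟨y₀, y₀ + e₀⟩ at the top level, or the sibling bond of the j-block y₀ of x₋ inside its parent block, has base end-point y₀ or a
lattice neighbour of y₀, and neighbouring j-blocks touch (2.46). [cite: Balaban1984PropagatorsII, (2.3)–(2.4) p.224, (2.45)–(2.46) p.231] -/
theorem exists_bondIdx_near (hk1 : 1 ≤ k) (x : PBond (PV d ℓ m K hd hL) 0) :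
    ∃ c : BondIdx (domT hN D hk), lvl hN D hk c = (blkV1 hN D x).1.1 ∧
      (geomT D).dist (β hN D hk c) (blkV1 hN D x) ≤ 1 ∧
      ((∃ c' : BondIdx (domT hN D hk), β hN D hk c' = blkV1 hN D x) → β hN D hk c = blkV1 hN D x) := by
  classical
  by_cases hcar : ∃ c' : BondIdx (domT hN D hk), β hN D hk c' = blkV1 hN D x
  · obtain ⟨c, hc⟩ := hcar
    refine ⟨c, ?_, ?_, fun _ => hc⟩
    · rw [← hc]; exact (beta_level hN D hk hk1 c).symm
    · rw [hc]; exact le_of_eq_of_le (dist_self_of_realizes (realizesT D) _) zero_le_one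
  -- no carrier: re-run [4] (2.3) keeping the location
  have hlev : (blkV1 hN D x).1.1 = D.lev (toBox hN x.src).1 := rfl
  set j := D.lev (toBox hN x.src).1 with hjdef
  have hj1 : 1 ≤ j := D.one_le_lev _
  have hjk : j ≤ k := D.lev_le _
  have hjmK : j ≤ m + K := hjk.trans hk
  set y₀ : Site (PV d ℓ m K hd hL) j := iterBlockOf j x.src with hy₀
  have hOm : y₀ ∈ (domT hN D hk).Om j := (iterBlockOf_mem_domT_iff hN D hk hj1 hjk x.src).2 le_rfl
  -- the block of `x` contains every fine site over `y₀`
  have hblk : ∀ w : Site (PV d ℓ m K hd hL) 0, iterBlockOf j w = y₀ → blkOf D.toDomains (toBox hN w) = blkV1 hN D x := by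
    intro w hw
    exact (blkOf_toBox_eq_iff hN D hk x.src w).2 (by rw [← hjdef, hw])
  -- an index bond `c` of level `j` whose underlying bond `b` has `y₀` as an end-point and is a unit bond of the j-lattice
  obtain ⟨b, hLam, hend⟩ : ∃ b : PBond (PV d ℓ m K hd hL) j, (domT hN D hk).LamBond j b ∧ (b.src = y₀ ∨ b.tgt = y₀) := by
    by_cases htop : j = k
    · have hnd : ∀ y : Site (PV d ℓ m K hd hL) j, ¬ (domT hN D hk).Deep j y := fun y =>
        (domT hN D hk).not_deep_of_le (show k ≤ j by omega) y
      exact ⟨⟨y₀, 0⟩, ⟨Or.inl hOm, hnd _, hnd _⟩, Or.inl rfl⟩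
    · have hL2 : 2 ≤ (PV d ℓ m K hd hL).L := by show 2 ≤ ℓ + 1; have := hL.2; omega
      have hdvd : (PV d ℓ m K hd hL).L ∣ (PV d ℓ m K hd hL).sitesPerDir j := by
        show ℓ + 1 ∣ 2 * (ℓ + 1) ^ (m + K - j)
        exact Dvd.dvd.mul_left (dvd_pow_self _ (by omega)) 2
      obtain ⟨b, hend, hsrc, htgt⟩ := exists_sibling_bond y₀ (0 : Fin (d + 1)) hL2 hdvd
      have hpar : blockOf y₀ ∉ (domT hN D hk).Om (j + 1) := by
        intro hmem
        have h' : iterBlockOf (j + 1) x.src ∈ (domT hN D hk).Om (j + 1) := by rwa [iterBlockOf_succ]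
        have := (iterBlockOf_mem_domT_iff hN D hk (by omega) (by omega) x.src).1 h'
        omega
      have hnds : ¬ (domT hN D hk).Deep j b.src := by
        show blockOf b.src ∉ (domT hN D hk).Om (j + 1)
        rw [hsrc]; exact hpar
      have hndt : ¬ (domT hN D hk).Deep j b.tgt := by
        show blockOf b.tgt ∉ (domT hN D hk).Om (j + 1)
        rw [htgt]; exact hpar
      have hOm' : b.src ∈ (domT hN D hk).Om j ∨ b.tgt ∈ (domT hN D hk).Om j := by
        rcases hend with h | h
        · exact Or.inl (h ▸ hOm)
        · exact Or.inr (h ▸ hOm)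
      exact ⟨b, ⟨hOm', hnds, hndt⟩, hend⟩
  let c : BondIdx (domT hN D hk) := ⟨⟨⟨j, by show j < k + 1; omega⟩, b⟩, hLam⟩
  have hlvl : lvl hN D hk c = j := rfl
  -- the carrier block of `c` contains every fine site over `base c`
  have hβc : ∀ w : Site (PV d ℓ m K hd hL) 0, iterBlockOf j w = base hN D hk c → blkOf D.toDomains (toBox hN w) = β hN D hk c :=
    fun w hw => blkOf_eq_beta hN D hk hk1 c hw
  refine ⟨c, hlvl.trans hlev.symm, ?_, fun h => absurd h hcar⟩
  -- `base c ∈ {b.src, b.tgt}`, `y₀ ∈ {b.src, b.tgt}`, `b.tgt = b.src + e_{b.dir}`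
  have hbase : base hN D hk c = b.src ∨ base hN D hk c = b.tgt := by
    unfold base; split_ifs
    · exact Or.inl rfl
    · exact Or.inr rfl
  have htgt : b.tgt = b.src.shift b.dir := rfl
  rcases hbase with hb | hb <;> rcases hend with he | he
  · -- base = src = y₀: the carrier is the block of x
    have : β hN D hk c = blkV1 hN D x := by
      obtain ⟨w, hw, -⟩ := exists_fine_over (hd := hd) (hL := hL) hjmK y₀ (fun _ => 0) (fun _ => by
        have := Nat.one_le_pow j (ℓ + 1) (Nat.succ_pos ℓ); omega)
      rw [← hβc w (by rw [hb, he]; exact hw), hblk w hw]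
    rw [this]; exact le_of_eq_of_le (dist_self_of_realizes (realizesT D) _) zero_le_one
  · -- base = src, tgt = y₀ = src + e: the block of x is the «+e» sibling of the carrier
    have h := (distT_le_one_of_sibling hN D hjmK b.src b.dir (s := β hN D hk c) (t := blkV1 hN D x)
      (fun w hw => hβc w (by rw [hb]; exact hw)) (fun w hw => hblk w (by rw [← he, htgt]; exact hw))).1
    exact h
  · -- base = tgt = src + e, src = y₀: the carrier is the «+e» sibling of the block of x
    have h := (distT_le_one_of_sibling hN D hjmK b.src b.dir (s := blkV1 hN D x) (t := β hN D hk c)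
      (fun w hw => hblk w (by rw [← he]; exact hw)) (fun w hw => hβc w (by rw [hb, htgt]; exact hw))).2
    exact h
  · -- base = tgt = y₀: the carrier is the block of x
    have : β hN D hk c = blkV1 hN D x := by
      obtain ⟨w, hw, -⟩ := exists_fine_over (hd := hd) (hL := hL) hjmK y₀ (fun _ => 0) (fun _ => by
        have := Nat.one_le_pow j (ℓ + 1) (Nat.succ_pos ℓ); omega)
      rw [← hβc w (by rw [hb, he]; exact hw), hblk w hw]
    rw [this]; exact le_of_eq_of_le (dist_self_of_realizes (realizesT D) _) zero_le_one

/-- ★ **A LEVEL-FAITHFUL, CARRIER-FAITHFUL AND 1-FAITHFUL TOTAL BLOCK MAP EXISTS** (by choice): `bI : fine bonds → index bonds` with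
(i) `lvl (bI x) = level of the block of x`, (ii) `β (bI x) = block of x` whenever the block of `x` is a carrier block `β c`, (iii)
`d_T(β (bI x), block of x) ≤ 1` — the three geometric binders `hlev`, `hβI`, `hβ1` of the N06 knit's coordinate pins, at EVERY member,
orphan blocks or not. [cite: Balaban1984PropagatorsII, (2.3)–(2.4) p.224, (2.45)–(2.46) p.231; Balaban1985BackgroundPropagators, (3.41) p.397, (3.46)–(3.47) p.398] -/
theorem exists_faithful (hk1 : 1 ≤ k) :
    ∃ bI : PBond (PV d ℓ m K hd hL) 0 → BondIdx (domT hN D hk),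
      (∀ x, lvl hN D hk (bI x) = (blkV1 hN D x).1.1) ∧
      (∀ (x : PBond (PV d ℓ m K hd hL) 0) (c : BondIdx (domT hN D hk)), blkV1 hN D x = β hN D hk c → β hN D hk (bI x) = blkV1 hN D x) ∧
      (∀ x, (geomT D).dist (β hN D hk (bI x)) (blkV1 hN D x) ≤ 1) :=
  ⟨fun x => (exists_bondIdx_near hN D hk hk1 x).choose,
    fun x => (exists_bondIdx_near hN D hk hk1 x).choose_spec.1,
    fun x c hc => (exists_bondIdx_near hN D hk hk1 x).choose_spec.2.2 ⟨c, hc.symm⟩,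
    fun x => (exists_bondIdx_near hN D hk hk1 x).choose_spec.2.1⟩

end IndexBonds

/-! ## §3 At a k-level census index -/

section Census

variable {b₀ b₁ : ℝ}

/-- **at every k-level V1 index** (hence at every member of def-Y's Stage 3′(Y)) a level-faithful, carrier-faithful and 1-faithful total
block map on the fine bonds exists (`1 ≤ k` from `KIdx.hk2`). [cite: Balaban1984PropagatorsII, (2.3)–(2.4) p.224, (2.45)–(2.46) p.231; Balaban1985BackgroundPropagators, (3.41) p.397] -/
theorem exists_faithful_kIdx (i : KIdx d ℓ hd hL b₀ b₁) :
    ∃ bI : PBond (PV d ℓ i.m i.K hd hL) 0 → BondIdx (domT i.hN i.D i.hk),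
      (∀ x, lvl i.hN i.D i.hk (bI x) = (blkV1 i.hN i.D x).1.1) ∧
      (∀ (x : PBond (PV d ℓ i.m i.K hd hL) 0) (c : BondIdx (domT i.hN i.D i.hk)),
          blkV1 i.hN i.D x = β i.hN i.D i.hk c → β i.hN i.D i.hk (bI x) = blkV1 i.hN i.D x) ∧
      (∀ x, (geomT i.D).dist (β i.hN i.D i.hk (bI x)) (blkV1 i.hN i.D x) ≤ 1) :=
  exists_faithful i.hN i.D i.hk (le_trans (by norm_num) i.hk2)

/-- ★ **… AND DIRECTION-BLIND** (the N06 certificate's fourth geometric binder `hbI0`, dag-n06-d `B9Thm31GpMajFromPinsPairM` ∕ `B9Proj349MajFromBlocks`):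
at every k-level V1 index a total block map exists that is level-faithful, carrier-faithful, 1-faithful AND constant on the `d+1` fine bonds issuing
from one point — `bI f = bI ⟨f.src, 0⟩`.  Proof: pre-compose any faithful map (`exists_faithful_kIdx`) with `f ↦ ⟨f.src, 0⟩`; the three
faithfulness clauses only see the block `blkV1 … f = blkOf D (toBox hN f.src)` of the SOURCE point (`rfl`).  Answers referee ref-A's WATCH-A3-PINS-DIRBLIND
(2026-08-28): the certificate's binder set `hlev hβI hβ1 hbI0` is jointly inhabited at every member. [cite: Balaban1984PropagatorsII, (2.3)–(2.4) p.224, (2.45)–(2.46) p.231; Balaban1985BackgroundPropagators, (3.41) p.397] -/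
theorem exists_faithful_dirBlind_kIdx (i : KIdx d ℓ hd hL b₀ b₁) :
    ∃ bI : PBond (PV d ℓ i.m i.K hd hL) 0 → BondIdx (domT i.hN i.D i.hk),
      (∀ x, lvl i.hN i.D i.hk (bI x) = (blkV1 i.hN i.D x).1.1) ∧
      (∀ (x : PBond (PV d ℓ i.m i.K hd hL) 0) (c : BondIdx (domT i.hN i.D i.hk)),
          blkV1 i.hN i.D x = β i.hN i.D i.hk c → β i.hN i.D i.hk (bI x) = blkV1 i.hN i.D x) ∧
      (∀ x, (geomT i.D).dist (β i.hN i.D i.hk (bI x)) (blkV1 i.hN i.D x) ≤ 1) ∧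
      (∀ x, bI x = bI ⟨x.src, 0⟩) := by
  obtain ⟨bI, hlev, hβI, hβ1⟩ := exists_faithful_kIdx i
  refine ⟨fun x => bI ⟨x.src, 0⟩, fun x => ?_, fun x c hc => ?_, fun x => ?_, fun _ => rfl⟩
  · have h : blkV1 i.hN i.D (⟨x.src, 0⟩ : PBond (PV d ℓ i.m i.K hd hL) 0) = blkV1 i.hN i.D x := rfl
    rw [← h]; exact hlev _
  · have h : blkV1 i.hN i.D (⟨x.src, 0⟩ : PBond (PV d ℓ i.m i.K hd hL) 0) = blkV1 i.hN i.D x := rfl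
    rw [← h]; exact hβI _ c (h ▸ hc)
  · have h : blkV1 i.hN i.D (⟨x.src, 0⟩ : PBond (PV d ℓ i.m i.K hd hL) 0) = blkV1 i.hN i.D x := rfl
    rw [← h]; exact hβ1 _

end Census

end Literature.MathematicalPhysics.QuantumFieldTheory.Balaban1983to89.B9IndexBondFaithful
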